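import Literature.AlgebraicGeometry.Modules.VanishingLocusOfHom
import Literature.AlgebraicGeometry.Morphisms.EqualizerLocusClosed
import Mathlib.AlgebraicGeometry.IdealSheaf.Functorial
import HarnessLib

/-!
# The containment locus «`X_T ⊆ Z_T`» is a closed subscheme of the base (assembly against the sheaf socket `hrep`)

Topic `Literature/AlgebraicGeometry/Morphisms`; theorems only (no definition, no named fact, no instance, no
`sorry`).  Cell hodgecm-mathlib, F-DAG second wave (h6-b2) (design of record
`B-provers/B-p16/g14/H6-DESIGN.B-p16g14.md`; (h6-a) ★ `Modules/ZeroSchemeUniversal`, (h6-b1) ★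
`Modules/VanishingLocusOfHom`, (h6-c) ★ `Morphisms/EqualizerLocusClosed`).  HC_CM is proved only modulo the
7 printed citations until rung 0 closes; nothing here changes that.

Let `p : X ⟶ S` be a morphism of schemes and `Z = V(𝓘) ⊆ X` the closed subscheme of an ideal sheaf
`𝓘 : X.IdealSheafData`.  For a base change `b : T ⟶ S` write `X_T := X ×_S T` with projection
`pr := pullback.fst p b : X_T ⟶ X`.  The CONTAINMENT condition «`X_T ⊆ Z_T` scheme-theoretically» (`Z_T = Z ×_X X_T`
is all of `X_T`) says that `pr` factors through `Z`, i.e. `𝓘 ≤ pr.ker` (the ideal sheaf of `Z` dies under `pr`);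
the equivalent spelling `𝓘.comap pr = ⊥` («the ideal of `Z_T ⊆ X_T` vanishes») is ★
`Resolution.HypersurfaceRestriction.le_ker_iff_comap_eq_bot` (Mathlib's Galois connection `comap ⊣ map`); §1 records
that containment is a subfunctor of `S` and that an ideal sheaf is determined by the subfunctor it cuts out.  MFK use it (Ch. 0 §5 (d), Ch. 6 Prop. 6.16, Ch. 7 Prop. 7.3) in the form «the identities cut out a
closed subscheme of the base»: for `p` projective and flat this subfunctor is represented by a CLOSED subscheme of `S`.
The proof (EGA III 7.7; [MumfordFogartyKirwan1994] Prop. 6.16) twists by `𝒪(n)`, `n ≫ 0`, so that `p_*𝒪_X(n)` is a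
vector bundle `𝓥` on `S` commuting with base change and `𝓘(n)` is generated by `𝓔 := p_*𝓘(n)`; then
`X_T ⊆ Z_T` iff the base change `b^*u` of `u : 𝓔 ⟶ 𝓥` vanishes.  THIS FILE is the assembly step downstream of that
sheaf-level statement, which it takes as the NAMED HYPOTHESIS

  `hrep : ∀ ⦃T⦄ (b : T ⟶ S), 𝓘 ≤ (pullback.fst p b).ker ↔ (Scheme.Modules.pullback b).map u = 0`

(the socket the cell's cohomology-and-base-change files produce): given ANY `u : 𝓔 ⟶ 𝓥` into a finite locally free
`𝓥` satisfying `hrep`, the vanishing locus `V(u) ⊆ S` of ★ `Modules/VanishingLocusOfHom` represents containment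
(§2), the representing ideal sheaf does not depend on the witness `u` (§1 `idealSheafData_eq_of_forall_le_ker_iff`, §2), and — for two
`S`-morphisms `f g : X ⟶ Y` into a separated `Y/S`, with `Z := Eq(f,g)` — «`f = g`» is the closed condition `V(u)`
(§3, ★ `Morphisms/EqualizerLocusClosed`).  Side sockets for the dischargers of `hrep`: with
`𝓥 := p_*𝒪_X(n)` finite locally free on a locally noetherian `S`, `hV : IsAffineLocalizing (dual 𝓥)` is ★
`Modules/SheafHomCoh.isAffineLocalizing_sheafHom`, and `hE : IsAffineLocalizing 𝓔` for the quasi-coherent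
`𝓔 := p_*𝓘(n)` is ★ `Modules/AffineLocalizing.IsAffineLocalizing.of_isQuasicoherent`; the test schemes `T` live
in the universe of `S` (as in ★ `Modules/VanishingLocusOfHom`).

* §1 `le_ker_fst_comp_of_le_ker_fst`, `idealSheafData_eq_of_forall_le_ker_iff`;
* §2 `vanishingIdeal_le_ker_iff_containment`, `exists_comp_subschemeι_eq_iff_containment`,
  `existsUnique_comp_subschemeι_eq_iff_containment`, `vanishingIdeal_eq_of_rep`;
* §3 `vanishingIdeal_le_ker_iff_pullback_map_eq`, `exists_comp_subschemeι_eq_iff_pullback_map_eq`.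

## References
* [MumfordFogartyKirwan1994] D. Mumford, J. Fogarty, F. Kirwan, *Geometric Invariant Theory*, 3rd ed. (1994),
  Ch. 6 §3 Prop. 6.16 (p. 126) (a closed subscheme of the base cut out by an identity of morphisms, via a map into
  a locally free sheaf).
* [GortzWedhorn2020] U. Görtz, T. Wedhorn, *Algebraic Geometry I: Schemes*, 2nd ed. (2020), Section (4.7)
  (pp. 107–108) (base change), Section (4.11) (inverse images and schematic intersections of subschemes),
  Definition/Proposition 9.7 (ii) (`Eq(f,g) ⊆ X` closed for `Y/S` separated).
* [Hartshorne1977] R. Hartshorne, *Algebraic Geometry* (1977), II Prop. 5.9 (PDF p. 146) (closed subschemes and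
  quasi-coherent ideal sheaves).
-/

noncomputable section

open CategoryTheory CategoryTheory.Limits AlgebraicGeometry

universe u

namespace Literature.AlgebraicGeometry.Morphisms

open Literature.AlgebraicGeometry.Modules

/-! ## §1 The containment condition `𝓘 ≤ pr.ker` and ideal sheaves as subfunctors -/

section Containment

variable {X S : Scheme.{u}} (p : X ⟶ S) (I : X.IdealSheafData)

/-- **Containment is a subfunctor of `S`**: if `X_T ⊆ Z_T` along `b : T ⟶ S` then `X_{T'} ⊆ Z_{T'}` along `c ≫ b`
for every `c : T' ⟶ T` (the projection `X ×_S T' ⟶ X` factors through `X ×_S T ⟶ X`).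
[cite: GortzWedhorn2020, Section (4.7) (pp. 107–108)] -/
theorem le_ker_fst_comp_of_le_ker_fst {T T' : Scheme.{u}} (b : T ⟶ S) (c : T' ⟶ T)
    (h : I ≤ (pullback.fst p b).ker) : I ≤ (pullback.fst p (c ≫ b)).ker := by
  have hfst : pullback.fst p (c ≫ b) =
      pullback.lift (pullback.fst p (c ≫ b)) (pullback.snd p (c ≫ b) ≫ c)
          (by rw [pullback.condition, Category.assoc]) ≫ pullback.fst p b :=
    (pullback.lift_fst _ _ _).symm
  rw [hfst]
  exact h.trans (Scheme.Hom.le_ker_comp _ _)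

end Containment

/-- **An ideal sheaf is determined by the subfunctor it cuts out**: if `J ≤ b.ker ↔ J' ≤ b.ker` for every test
morphism `b : T ⟶ S`, then `J = J'` (test with the two closed immersions `V(J) ⟶ S`, `V(J') ⟶ S`, whose kernels
are `J`, `J'` — Mathlib `Scheme.IdealSheafData.ker_subschemeι`).  In particular a closed subscheme representing a
given subfunctor of `S` is unique. [cite: Hartshorne1977, II Prop. 5.9 (PDF p. 146)] -/
theorem idealSheafData_eq_of_forall_le_ker_iff {S : Scheme.{u}} {J J' : S.IdealSheafData}
    (h : ∀ ⦃T : Scheme.{u}⦄ (b : T ⟶ S), J ≤ b.ker ↔ J' ≤ b.ker) : J = J' := by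
  apply le_antisymm
  · have h' := (h J'.subschemeι).2 (by rw [Scheme.IdealSheafData.ker_subschemeι])
    rwa [Scheme.IdealSheafData.ker_subschemeι] at h'
  · have h' := (h J.subschemeι).1 (by rw [Scheme.IdealSheafData.ker_subschemeι])
    rwa [Scheme.IdealSheafData.ker_subschemeι] at h'

/-! ## §2 The containment locus from the sheaf socket `hrep`

`u : 𝓔 ⟶ 𝓥` is a morphism of `𝒪_S`-modules with `𝓥` finite locally free (a frame system `F`), `𝓔` and `𝓥^∨`
affine-localizing (e.g. quasi-coherent), and `hrep` says that `b^*u = 0` detects containment along every `b : T ⟶ S`. -/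

section Rep

variable {X S : Scheme.{u}} (p : X ⟶ S) (I : X.IdealSheafData) {E V : S.Modules} (u : E ⟶ V)

/-- **The containment locus is the closed subscheme `V(u) ⊆ S`** (ideal form): for every `b : T ⟶ S`,
`vanishingIdeal u ≤ b.ker ↔ X_T ⊆ Z_T` (★ `vanishingIdeal_le_ker_iff` composed with the socket `hrep`).
[cite: MumfordFogartyKirwan1994, Ch. 6 §3 Prop. 6.16 (p. 126)] [cite: Hartshorne1977, II Prop. 5.9 (PDF p. 146)] -/
theorem vanishingIdeal_le_ker_iff_containment (F : FrameSystem V) (hE : IsAffineLocalizing E)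
    (hV : IsAffineLocalizing (dual V))
    (hrep : ∀ ⦃T : Scheme.{u}⦄ (b : T ⟶ S),
      I ≤ (pullback.fst p b).ker ↔ (Scheme.Modules.pullback b).map u = 0)
    {T : Scheme.{u}} (b : T ⟶ S) :
    vanishingIdeal u ≤ b.ker ↔ I ≤ (pullback.fst p b).ker :=
  (vanishingIdeal_le_ker_iff u b F hE hV).trans (hrep b).symm

/-- **The containment locus represents containment** (factorisation form): `b : T ⟶ S` factors through the closed
subscheme `V(u) ⟶ S` iff `X_T ⊆ Z_T`. [cite: MumfordFogartyKirwan1994, Ch. 6 §3 Prop. 6.16 (p. 126)]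
[cite: Hartshorne1977, II Prop. 5.9 (PDF p. 146)] -/
theorem exists_comp_subschemeι_eq_iff_containment (F : FrameSystem V) (hE : IsAffineLocalizing E)
    (hV : IsAffineLocalizing (dual V))
    (hrep : ∀ ⦃T : Scheme.{u}⦄ (b : T ⟶ S),
      I ≤ (pullback.fst p b).ker ↔ (Scheme.Modules.pullback b).map u = 0)
    {T : Scheme.{u}} (b : T ⟶ S) :
    (∃ b' : T ⟶ (vanishingIdeal u).subscheme, b' ≫ (vanishingIdeal u).subschemeι = b) ↔
      I ≤ (pullback.fst p b).ker :=
  (exists_comp_subschemeι_eq_iff u b F hE hV).trans (hrep b).symm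

/-- Unique factorisation: `V(u) ⟶ S` is a monomorphism, so `V(u)` REPRESENTS the containment subfunctor
`T ↦ {b : T ⟶ S | X_T ⊆ Z_T}`. [cite: MumfordFogartyKirwan1994, Ch. 6 §3 Prop. 6.16 (p. 126)]
[cite: Hartshorne1977, II Prop. 5.9 (PDF p. 146)] -/
theorem existsUnique_comp_subschemeι_eq_iff_containment (F : FrameSystem V) (hE : IsAffineLocalizing E)
    (hV : IsAffineLocalizing (dual V))
    (hrep : ∀ ⦃T : Scheme.{u}⦄ (b : T ⟶ S),
      I ≤ (pullback.fst p b).ker ↔ (Scheme.Modules.pullback b).map u = 0)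
    {T : Scheme.{u}} (b : T ⟶ S) :
    (∃! b' : T ⟶ (vanishingIdeal u).subscheme, b' ≫ (vanishingIdeal u).subschemeι = b) ↔
      I ≤ (pullback.fst p b).ker :=
  (existsUnique_comp_subschemeι_eq_iff u b F hE hV).trans (hrep b).symm

/-- **The containment locus does not depend on the witness**: two morphisms `u : 𝓔 ⟶ 𝓥`, `u' : 𝓔' ⟶ 𝓥'` both
satisfying the socket (e.g. built from two twists `n, n' ≫ 0`) have the same vanishing ideal sheaf (§1
`idealSheafData_eq_of_forall_le_ker_iff`). [cite: MumfordFogartyKirwan1994, Ch. 6 §3 Prop. 6.16 (p. 126)] -/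
theorem vanishingIdeal_eq_of_rep (F : FrameSystem V) (hE : IsAffineLocalizing E)
    (hV : IsAffineLocalizing (dual V))
    (hrep : ∀ ⦃T : Scheme.{u}⦄ (b : T ⟶ S),
      I ≤ (pullback.fst p b).ker ↔ (Scheme.Modules.pullback b).map u = 0)
    {E' V' : S.Modules} (u' : E' ⟶ V') (F' : FrameSystem V') (hE' : IsAffineLocalizing E')
    (hV' : IsAffineLocalizing (dual V'))
    (hrep' : ∀ ⦃T : Scheme.{u}⦄ (b : T ⟶ S),
      I ≤ (pullback.fst p b).ker ↔ (Scheme.Modules.pullback b).map u' = 0) :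
    vanishingIdeal u = vanishingIdeal u' :=
  idealSheafData_eq_of_forall_le_ker_iff fun _ b =>
    (vanishingIdeal_le_ker_iff_containment p I u F hE hV hrep b).trans
      (vanishingIdeal_le_ker_iff_containment p I u' F' hE' hV' hrep' b).symm

end Rep

/-! ## §3 «`f = g`» is the closed condition `V(u)`

For `S`-schemes `X Y : Over S`, `f g : X ⟶ Y` with `Y ⟶ S` separated, take `Z := Eq(f,g)`, i.e.
`𝓘 := (equalizer.ι f g).left.ker` and `p := X.hom`; then containment «`X_T ⊆ Eq(f,g)_T`» is «`f_T = g_T`»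
(★ `Morphisms/EqualizerLocusClosed`). -/

section Equalizer

variable {S : Scheme.{u}} {X Y : Over S} (f g : X ⟶ Y) {E V : S.Modules} (u : E ⟶ V)

/-- **«`f = g`» is a closed condition on the base**, cut out by the vanishing locus `V(u)` of any sheaf witness `u`
of the containment socket for `Z := Eq(f,g)`: `vanishingIdeal u ≤ b.ker ↔ f_T = g_T`.
[cite: MumfordFogartyKirwan1994, Ch. 6 §3 Prop. 6.16 (p. 126)]
[cite: GortzWedhorn2020, Definition/Proposition 9.7 (ii) and Section (4.7) (pp. 107–108)] -/
theorem vanishingIdeal_le_ker_iff_pullback_map_eq [IsSeparated Y.hom] (F : FrameSystem V)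
    (hE : IsAffineLocalizing E) (hV : IsAffineLocalizing (dual V))
    (hrep : ∀ ⦃T : Scheme.{u}⦄ (b : T ⟶ S),
      (equalizer.ι f g).left.ker ≤ (pullback.fst X.hom b).ker ↔ (Scheme.Modules.pullback b).map u = 0)
    {T : Scheme.{u}} (b : T ⟶ S) :
    vanishingIdeal u ≤ b.ker ↔ (Over.pullback b).map f = (Over.pullback b).map g :=
  le_ker_iff_pullback_map_eq_of_containment f g (vanishingIdeal u)
    (fun _ b' => vanishingIdeal_le_ker_iff_containment X.hom _ u F hE hV hrep b') b

/-- Factorisation form: `b : T ⟶ S` factors through `V(u) ⟶ S` iff `f_T = g_T`.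
[cite: MumfordFogartyKirwan1994, Ch. 6 §3 Prop. 6.16 (p. 126)]
[cite: GortzWedhorn2020, Definition/Proposition 9.7 (ii) and Section (4.7) (pp. 107–108)] -/
theorem exists_comp_subschemeι_eq_iff_pullback_map_eq [IsSeparated Y.hom] (F : FrameSystem V)
    (hE : IsAffineLocalizing E) (hV : IsAffineLocalizing (dual V))
    (hrep : ∀ ⦃T : Scheme.{u}⦄ (b : T ⟶ S),
      (equalizer.ι f g).left.ker ≤ (pullback.fst X.hom b).ker ↔ (Scheme.Modules.pullback b).map u = 0)
    {T : Scheme.{u}} (b : T ⟶ S) :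
    (∃ b' : T ⟶ (vanishingIdeal u).subscheme, b' ≫ (vanishingIdeal u).subschemeι = b) ↔
      (Over.pullback b).map f = (Over.pullback b).map g :=
  exists_comp_subschemeι_eq_iff_pullback_map_eq_of_containment f g (vanishingIdeal u)
    (fun _ b' => vanishingIdeal_le_ker_iff_containment X.hom _ u F hE hV hrep b') b

end Equalizer

end Literature.AlgebraicGeometry.Morphisms

end
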